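import Mathlib.Data.ZMod.Basic
import Literature.Topology.FourManifolds.KhResolutions
import HarnessLib

/-!
# The standard Gauss diagram of the torus knot `T(p, q)` and its Seifert circles

This file (topic `Topology/FourManifolds`, companion of `KhResolutions` / `LeeRasmussen` /
`Rasmussen`) provides the combinatorial half of the computation of Rasmussen's invariant of the
torus knots (`Rasmussen.hasRasmussenInvariant_torusKnot`, Rasmussen (2010), Thm. 4 and §5.2):

* `torusGauss p q : GaussDiagram` — the Gauss diagram with `n = q (p - 1)` chords, all of sign
  `+1`, read off the stereographic projection of the torus knot `z ↦ (zᵖ, z^q)/√2`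
  (`Literature.Topology.FourManifolds.torusKnotMap`; the realisation itself is proved in the
  companion file on the regular projection). Its `2 q (p - 1)` marked points come in `2q`
  blocks of `p - 1` consecutive points (`TorusGauss.pos b c`); the even blocks carry the
  under-passages, the odd blocks the over-passages, and the chord with under-passage at
  `(2β, c)` has its over-passage at `(2β' + 1, p - 2 - c)` with `β' ≡ β - 1 + (c + 1) p⁻¹ (mod q)`
  (`TorusGauss.oidx`, `TorusGauss.uidx`; `p⁻¹` is `TorusGauss.pinv`). This is the diagram of the
  closure of a positive `p`-braid with `(p - 1) q` crossings (Rasmussen (2010), §5.2: a positive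
  diagram of `T(p, q)` with `n = (p - 1) q` crossings and `k = p` Seifert circles).
* the **levels** `TorusGauss.lvl` of the `2n` arcs (`c + 1` after an even-block point at offset
  `c`, `p - 2 - c` after an odd-block point): the radial rank of the arc in the closed-braid
  picture;
* the **successor arc map** `TorusGauss.nxt = partner ∘ succPt` (following the Seifert
  smoothing), the invariance `lvl_nxt`, the lap lemma `exists_iterate_nxt_eq_shiftPos` (one turn
  along a level shifts the block by `p⁻¹ (mod q)`), and `exists_iterate_nxt`: two arcs of the
  same level lie on one `nxt`-orbit (this uses `gcd(p, q) = 1`);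
* the identification of state circles (`GaussDiagram.StateCircle`, `KhResolutions`) with levels:
  `reachable_seifert_iff` / `circleOf_seifert_eq_iff` — in the all-`0` state (the oriented,
  Seifert resolution: all chords are positive) two arcs lie on the same circle iff they have the
  same level, so that the oriented resolution has exactly `p` circles; and
  `reachable_update_iff` / `circleOf_update_eq_iff` — after flipping the single chord `(β, c)`
  the circles are the levels with `c` and `c + 1` merged (every edge out of the oriented
  resolution is a merge of two adjacent Seifert circles).

## Sources

* J. Rasmussen, *Khovanov homology and the slice genus*, Invent. Math. 182 (2010) 419–447,
  §5.2 (positive diagrams: the oriented resolution is the `0`-resolution; `s = n - k + 1`),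
  Thm. 4, Cor. 1 (torus knots).
* D. Rolfsen, *Knots and Links* (1976), §3.C (torus knots as curves on the standard torus).
* O. Viro, *Khovanov homology, its definitions and ramifications*, Fund. Math. 184 (2004), §2, §5
  (states of a Gauss diagram as abstract circle surgery; the model of `KhResolutions`).
* Mathlib: `finProdFinEquiv`, `ZMod` (casts `ZMod.natCast_mod`, `ZMod.coe_mul_inv_eq_one`),
  `SimpleGraph.Reachable` / `ConnectedComponent`, `Function.iterate`, `Nat.find`.

## Design choices

* Everything is total in `p q : ℕ` (no hypotheses in definitions); `gcd(p, q) = 1` enters only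
  the lap lemma at the innermost level (`p p⁻¹ ≡ 1 (mod q)`) and `q (p - 1) ≥ 1` only where arcs
  must be marked points. All block arithmetic is done through casts to `ZMod q`
  (`cast_oidx`, `cast_uidx`, `fin_eq_of_cast_eq`).
* Circles are handled through the arc-end gluing API of `KhResolutions`
  (`reachable_endArc_endGlue`, `succPt`, `predPt`): one step of `nxt` is one Seifert gluing, so
  reachability along a level is an iterate of `nxt`; the converse (adjacent arcs have equal
  levels, except across a non-Seifert gluing) is `lvl_eq_or_of_adj`.
* Not here: the regular projection of `torusKnot p q` reading `torusGauss p q`, and the Lee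
  homology computation (`rasmussenInvariant (torusGauss p q) = (p - 1) (q - 1)`); they live in
  the companion files. No new named facts are introduced (D-0026).
-/

open Function Set

namespace Literature.Topology.FourManifolds

namespace TorusGauss

/-! ## Modular bookkeeping -/

/-- The inverse of `p` modulo `q`, as a natural number (`((p : ZMod q)⁻¹).val`): for coprime
`p, q` one has `p * pinv p q ≡ 1 (mod q)` (`natCast_mul_pinv`). [folklore] -/
def pinv (p q : ℕ) : ℕ := ((p : ZMod q)⁻¹).val

/-- `p * pinv p q = 1` in `ZMod q` for coprime `p, q`. [folklore] -/
theorem natCast_mul_pinv {p q : ℕ} (hq : 0 < q) (h : p.Coprime q) :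
    ((p : ZMod q) * (pinv p q : ZMod q)) = 1 := by
  haveI : NeZero q := ⟨hq.ne'⟩
  rw [pinv, ZMod.natCast_zmod_val]
  exact ZMod.coe_mul_inv_eq_one p h

/-- Two indices `β, β' < q` with the same residue in `ZMod q` are equal. [folklore] -/
theorem fin_eq_of_cast_eq {q : ℕ} {β β' : Fin q}
    (h : ((β : ℕ) : ZMod q) = ((β' : ℕ) : ZMod q)) : β = β' := by
  rw [ZMod.natCast_eq_natCast_iff', Nat.mod_eq_of_lt β.isLt, Nat.mod_eq_of_lt β'.isLt] at h
  exact Fin.ext h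

/-! ## Marked points: blocks and offsets -/

/-- The marked point in block `b` (`0 ≤ b < 2q`) at offset `c` (`0 ≤ c < p - 1`): the position
number `(p - 1) * b + c` among the `2 q (p - 1)` passages through crossings. [folklore] -/
def pos (p q : ℕ) (b : Fin (2 * q)) (c : Fin (p - 1)) : Fin (2 * (q * (p - 1))) :=
  ⟨(p - 1) * b + c, by
    have hb := b.isLt
    have hc := c.isLt
    calc (p - 1) * b + c < (p - 1) * b + (p - 1) := by omega
      _ = (p - 1) * (b + 1) := by ring
      _ ≤ (p - 1) * (2 * q) := Nat.mul_le_mul_left _ hb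
      _ = 2 * (q * (p - 1)) := by ring⟩

/-- The position number of `pos p q b c` is `(p - 1) * b + c`. [folklore] -/
@[simp]
theorem pos_val {p q : ℕ} (b : Fin (2 * q)) (c : Fin (p - 1)) :
    (pos p q b c).val = (p - 1) * b + c := rfl

/-- The block of `pos p q b c` is `b`. [folklore] -/
theorem pos_div {p q : ℕ} (b : Fin (2 * q)) (c : Fin (p - 1)) :
    (pos p q b c).val / (p - 1) = b := by
  have hc := c.isLt
  rw [pos_val, Nat.add_comm, Nat.add_mul_div_left _ _ (by omega), Nat.div_eq_of_lt hc,
    zero_add]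

/-- The offset of `pos p q b c` is `c`. [folklore] -/
theorem pos_mod {p q : ℕ} (b : Fin (2 * q)) (c : Fin (p - 1)) :
    (pos p q b c).val % (p - 1) = c := by
  rw [pos_val, Nat.add_comm, Nat.add_mul_mod_self_left, Nat.mod_eq_of_lt c.isLt]

/-- `pos` is injective in (block, offset). [folklore] -/
theorem pos_eq_pos_iff {p q : ℕ} {b b' : Fin (2 * q)} {c c' : Fin (p - 1)} :
    pos p q b c = pos p q b' c' ↔ b = b' ∧ c = c' := by
  refine ⟨fun h ↦ ⟨Fin.ext ?_, Fin.ext ?_⟩, by rintro ⟨rfl, rfl⟩; rfl⟩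
  · rw [← pos_div b c, ← pos_div b' c', h]
  · rw [← pos_mod b c, ← pos_mod b' c', h]

/-- The block `x / (p - 1) < 2q` of a marked point `x`. [folklore] -/
def blk {p q : ℕ} (x : Fin (2 * (q * (p - 1)))) : Fin (2 * q) :=
  ⟨x.val / (p - 1),
    Nat.div_lt_of_lt_mul (by have := x.isLt; linarith [Nat.mul_comm (p - 1) (2 * q)])⟩

/-- The offset `x % (p - 1)` of a marked point `x`. [folklore] -/
def off {p q : ℕ} (x : Fin (2 * (q * (p - 1)))) : Fin (p - 1) :=
  ⟨x.val % (p - 1), Nat.mod_lt _ (by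
    have := x.isLt
    rcases Nat.eq_zero_or_pos (p - 1) with h | h
    · simp [h] at this
    · exact h)⟩

/-- Every marked point is `pos` of its block and offset. [folklore] -/
@[simp]
theorem pos_blk_off {p q : ℕ} (x : Fin (2 * (q * (p - 1)))) : pos p q (blk x) (off x) = x :=
  Fin.ext (Nat.div_add_mod _ _)

/-- The block of `pos p q b c` (as an element of `Fin (2q)`). [folklore] -/
@[simp]
theorem blk_pos {p q : ℕ} (b : Fin (2 * q)) (c : Fin (p - 1)) : blk (pos p q b c) = b :=
  Fin.ext (pos_div b c)

/-- The offset of `pos p q b c` (as an element of `Fin (p - 1)`). [folklore] -/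
@[simp]
theorem off_pos {p q : ℕ} (b : Fin (2 * q)) (c : Fin (p - 1)) : off (pos p q b c) = c :=
  Fin.ext (pos_mod b c)

/-- The even block `2β` (the `β`-th block of under-passages). [folklore] -/
def ublk {q : ℕ} (β : Fin q) : Fin (2 * q) := ⟨2 * β, by omega⟩

/-- The odd block `2β + 1` (the `β`-th block of over-passages). [folklore] -/
def oblk {q : ℕ} (β : Fin q) : Fin (2 * q) := ⟨2 * β + 1, by omega⟩

/-- The number of the even block `2β`. [folklore] -/
@[simp] theorem ublk_val {q : ℕ} (β : Fin q) : (ublk β).val = 2 * β := rfl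

/-- The number of the odd block `2β + 1`. [folklore] -/
@[simp] theorem oblk_val {q : ℕ} (β : Fin q) : (oblk β).val = 2 * β + 1 := rfl

/-- `ublk` is injective. [folklore] -/
theorem ublk_inj {q : ℕ} {β β' : Fin q} : ublk β = ublk β' ↔ β = β' :=
  ⟨fun h ↦ Fin.ext (by have := congrArg Fin.val h; simp at this; omega), fun h ↦ h ▸ rfl⟩

/-- `oblk` is injective. [folklore] -/
theorem oblk_inj {q : ℕ} {β β' : Fin q} : oblk β = oblk β' ↔ β = β' :=
  ⟨fun h ↦ Fin.ext (by have := congrArg Fin.val h; simp at this; omega), fun h ↦ h ▸ rfl⟩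

/-- An even block is not an odd block. [folklore] -/
theorem ublk_ne_oblk {q : ℕ} (β β' : Fin q) : ublk β ≠ oblk β' := fun h ↦ by
  have := congrArg Fin.val h; simp at this; omega

/-- Half of a block index. [folklore] -/
def hblk {q : ℕ} (b : Fin (2 * q)) : Fin q := ⟨b / 2, by omega⟩

/-- Every block is the even or the odd block of its half. [folklore] -/
theorem eq_ublk_or_eq_oblk {q : ℕ} (b : Fin (2 * q)) : b = ublk (hblk b) ∨ b = oblk (hblk b) := by
  rcases Nat.even_or_odd b.val with ⟨k, hk⟩ | ⟨k, hk⟩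
  · left; apply Fin.ext; simp [hblk]; omega
  · right; apply Fin.ext; simp [hblk]; omega

/-- Half of the even block `2β` is `β`. [folklore] -/
@[simp] theorem hblk_ublk {q : ℕ} (β : Fin q) : hblk (ublk β) = β := Fin.ext (by simp [hblk])

/-- Half of the odd block `2β + 1` is `β`. [folklore] -/
@[simp] theorem hblk_oblk {q : ℕ} (β : Fin q) : hblk (oblk β) = β := Fin.ext (by simp [hblk]; omega)

/-! ## The chord pairing -/

/-- The half-block index of the over-passage of the chord whose under-passage lies in the even
block `2β` at offset `c`: `β - 1 + (c + 1) p⁻¹ (mod q)` (`cast_oidx`). [folklore] -/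
def oidx (p q : ℕ) (β : Fin q) (c : Fin (p - 1)) : Fin q :=
  ⟨(β + (q - 1) + (c + 1) * pinv p q) % q, Nat.mod_lt _ β.pos⟩

/-- The inverse bookkeeping: the half-block index `β' + 1 - (c + 1) p⁻¹ (mod q)` of the
under-passage (at offset `c`) of the chord whose over-passage lies in the odd block `2β' + 1`
(`cast_uidx`, `oidx_uidx`, `uidx_oidx`). [folklore] -/
def uidx (p q : ℕ) (β : Fin q) (c : Fin (p - 1)) : Fin q :=
  ⟨(β + 1 + (q - (c + 1) * pinv p q % q)) % q, Nat.mod_lt _ β.pos⟩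

/-- `oidx` in `ZMod q`. [folklore] -/
theorem cast_oidx {p q : ℕ} (β : Fin q) (c : Fin (p - 1)) :
    ((oidx p q β c : ℕ) : ZMod q) = (β : ℕ) - 1 + ((c : ℕ) + 1) * (pinv p q : ℕ) := by
  have hq : 1 ≤ q := β.pos
  simp only [oidx, ZMod.natCast_mod, Nat.cast_add, Nat.cast_mul, Nat.cast_sub hq,
    ZMod.natCast_self, Nat.cast_one]
  ring

/-- `uidx` in `ZMod q`. [folklore] -/
theorem cast_uidx {p q : ℕ} (β : Fin q) (c : Fin (p - 1)) :
    ((uidx p q β c : ℕ) : ZMod q) = (β : ℕ) + 1 - ((c : ℕ) + 1) * (pinv p q : ℕ) := by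
  have hq : 0 < q := β.pos
  have hr : (c + 1) * pinv p q % q ≤ q := (Nat.mod_lt _ hq).le
  simp only [uidx, ZMod.natCast_mod, Nat.cast_add, Nat.cast_sub hr, ZMod.natCast_self,
    Nat.cast_one, Nat.cast_mul]
  ring

/-- `oidx ∘ uidx = id` (at a fixed offset). [folklore] -/
@[simp]
theorem oidx_uidx {p q : ℕ} (β : Fin q) (c : Fin (p - 1)) : oidx p q (uidx p q β c) c = β :=
  fin_eq_of_cast_eq (by rw [cast_oidx, cast_uidx]; ring)

/-- `uidx ∘ oidx = id` (at a fixed offset). [folklore] -/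
@[simp]
theorem uidx_oidx {p q : ℕ} (β : Fin q) (c : Fin (p - 1)) : uidx p q (oidx p q β c) c = β :=
  fin_eq_of_cast_eq (by rw [cast_uidx, cast_oidx]; ring)

/-- The under-passage of the chord `(β, c)`: block `2β`, offset `c`. [folklore] -/
def uPos (p q : ℕ) (β : Fin q) (c : Fin (p - 1)) : Fin (2 * (q * (p - 1))) :=
  pos p q (ublk β) c

/-- The over-passage of the chord `(β, c)`: block `2 (oidx β c) + 1`, offset `p - 2 - c`.
[folklore] -/
def oPos (p q : ℕ) (β : Fin q) (c : Fin (p - 1)) : Fin (2 * (q * (p - 1))) :=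
  pos p q (oblk (oidx p q β c)) (Fin.rev c)

/-- `uPos` is injective. [folklore] -/
theorem uPos_eq_uPos_iff {p q : ℕ} {β β' : Fin q} {c c' : Fin (p - 1)} :
    uPos p q β c = uPos p q β' c' ↔ β = β' ∧ c = c' := by
  rw [uPos, uPos, pos_eq_pos_iff, ublk_inj]

/-- `oPos` is injective. [folklore] -/
theorem oPos_eq_oPos_iff {p q : ℕ} {β β' : Fin q} {c c' : Fin (p - 1)} :
    oPos p q β c = oPos p q β' c' ↔ β = β' ∧ c = c' := by
  rw [oPos, oPos, pos_eq_pos_iff, oblk_inj, Fin.rev_inj]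
  refine ⟨fun ⟨h1, h2⟩ ↦ ⟨?_, h2⟩, by rintro ⟨rfl, rfl⟩; exact ⟨rfl, rfl⟩⟩
  subst h2
  rw [← uidx_oidx β c, h1, uidx_oidx]

/-- An under-passage is not an over-passage (even versus odd block). [folklore] -/
theorem uPos_ne_oPos {p q : ℕ} (β β' : Fin q) (c c' : Fin (p - 1)) :
    uPos p q β c ≠ oPos p q β' c' := fun h ↦
  ublk_ne_oblk _ _ (pos_eq_pos_iff.1 h).1

/-- The over-passage of the chord through the over-position in block `2β' + 1`, offset `c'`:
`pos (oblk β') c' = oPos (uidx β' (rev c')) (rev c')`. [folklore] -/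
theorem pos_oblk {p q : ℕ} (β : Fin q) (c : Fin (p - 1)) :
    pos p q (oblk β) c = oPos p q (uidx p q β (Fin.rev c)) (Fin.rev c) := by
  rw [oPos, oidx_uidx, Fin.rev_rev]

/-- `pos (ublk β) c = uPos β c`. [folklore] -/
theorem pos_ublk {p q : ℕ} (β : Fin q) (c : Fin (p - 1)) : pos p q (ublk β) c = uPos p q β c := rfl

end TorusGauss

open TorusGauss in
/-- **The standard Gauss diagram of the torus knot `T(p, q)`** (`p, q ≥ 2` coprime), with
`n = q (p - 1)` chords, all positive: the `2 q (p - 1)` marked points come in `2q` blocks of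
`p - 1`; the chord indexed by `(β, c) ∈ Fin q × Fin (p - 1)` (via `finProdFinEquiv`) has its
under-passage in the even block `2β` at offset `c` and its over-passage in the odd block
`2 (β - 1 + (c + 1) p⁻¹ mod q) + 1` at offset `p - 2 - c`. It is the diagram read off the
stereographic projection of `z ↦ (zᵖ, z^q)/√2` (`torusKnotMap`), a closed positive `p`-braid with
`(p - 1) q` crossings (Rasmussen (2010), §5.2; Rolfsen (1976), §3.C). Total in `p, q` (for
non-coprime `p, q` it is not the diagram of a knot). [cite: Rasmussen2010, §5.2] -/
def torusGauss (p q : ℕ) : GaussDiagram where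
  n := q * (p - 1)
  overPos i := oPos p q (finProdFinEquiv.symm i).1 (finProdFinEquiv.symm i).2
  underPos i := uPos p q (finProdFinEquiv.symm i).1 (finProdFinEquiv.symm i).2
  sign _ := 1
  bijective := by
    refine (Fintype.bijective_iff_injective_and_card _).2 ⟨?_, by simp [two_mul]⟩
    refine Function.Injective.sumElim (fun i j h ↦ ?_) (fun i j h ↦ ?_) (fun i j h ↦ ?_)
    · exact finProdFinEquiv.symm.injective (Prod.ext (oPos_eq_oPos_iff.1 h).1
        (oPos_eq_oPos_iff.1 h).2)
    · exact finProdFinEquiv.symm.injective (Prod.ext (uPos_eq_uPos_iff.1 h).1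
        (uPos_eq_uPos_iff.1 h).2)
    · exact uPos_ne_oPos _ _ _ _ h.symm

namespace TorusGauss

variable (p q : ℕ)

/-- The torus diagram has `q (p - 1)` chords. [folklore] -/
@[simp] theorem n_eq : (torusGauss p q).n = q * (p - 1) := rfl

/-- All chords of the torus diagram are positive. [folklore] -/
@[simp] theorem sign_eq (i : Fin (torusGauss p q).n) : (torusGauss p q).sign i = 1 := rfl

/-- The over-passage of chord `i ↔ (β, c)`. [folklore] -/
theorem overPos_eq (i : Fin (torusGauss p q).n) :
    (torusGauss p q).overPos i = oPos p q (finProdFinEquiv.symm i).1 (finProdFinEquiv.symm i).2 :=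
  rfl

/-- The under-passage of chord `i ↔ (β, c)`. [folklore] -/
theorem underPos_eq (i : Fin (torusGauss p q).n) :
    (torusGauss p q).underPos i = uPos p q (finProdFinEquiv.symm i).1 (finProdFinEquiv.symm i).2 :=
  rfl

/-- The chord with index `(β, c)`. [folklore] -/
def chord (β : Fin q) (c : Fin (p - 1)) : Fin (torusGauss p q).n := finProdFinEquiv (β, c)

/-- The over-passage of `chord β c` is `oPos β c`. [folklore] -/
@[simp] theorem overPos_chord (β : Fin q) (c : Fin (p - 1)) :
    (torusGauss p q).overPos (chord p q β c) = oPos p q β c := by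
  simp [overPos_eq, chord]

/-- The under-passage of `chord β c` is `uPos β c`. [folklore] -/
@[simp] theorem underPos_chord (β : Fin q) (c : Fin (p - 1)) :
    (torusGauss p q).underPos (chord p q β c) = uPos p q β c := by
  simp [underPos_eq, chord]

/-- Every chord is `chord β c` for some `(β, c)`. [folklore] -/
theorem chord_surjective (i : Fin (torusGauss p q).n) :
    ∃ β c, chord p q β c = i :=
  ⟨(finProdFinEquiv.symm i).1, (finProdFinEquiv.symm i).2, by
    rw [chord, Prod.mk.eta, Equiv.apply_symm_apply]⟩

/-- The partner of an under-passage. [folklore] -/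
@[simp] theorem partner_uPos (β : Fin q) (c : Fin (p - 1)) :
    (torusGauss p q).partner (uPos p q β c) = oPos p q β c := by
  rw [← underPos_chord, GaussDiagram.partner_underPos, overPos_chord]

/-- The partner of an over-passage. [folklore] -/
@[simp] theorem partner_oPos (β : Fin q) (c : Fin (p - 1)) :
    (torusGauss p q).partner (oPos p q β c) = uPos p q β c := by
  rw [← overPos_chord, GaussDiagram.partner_overPos, underPos_chord]

/-- The chord through an under-passage. [folklore] -/
@[simp] theorem chordOf_uPos (β : Fin q) (c : Fin (p - 1)) :
    (torusGauss p q).chordOf (uPos p q β c) = chord p q β c := by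
  rw [← underPos_chord, GaussDiagram.chordOf_underPos]

/-- The chord through an over-passage. [folklore] -/
@[simp] theorem chordOf_oPos (β : Fin q) (c : Fin (p - 1)) :
    (torusGauss p q).chordOf (oPos p q β c) = chord p q β c := by
  rw [← overPos_chord, GaussDiagram.chordOf_overPos]

/-- `n₊ = n`: all chords are positive. [folklore] -/
@[simp] theorem nPlus_eq : (torusGauss p q).nPlus = q * (p - 1) := by
  rw [GaussDiagram.nPlus, Finset.filter_true_of_mem fun i _ ↦ sign_eq p q i, Finset.card_univ,
    Fintype.card_fin, n_eq]

/-- `n₋ = 0`: no chord is negative. [folklore] -/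
@[simp] theorem nMinus_eq : (torusGauss p q).nMinus = 0 := by
  rw [GaussDiagram.nMinus, Finset.filter_false_of_mem fun i _ ↦ by rw [sign_eq]; decide,
    Finset.card_empty]

/-- The writhe of the torus diagram is `q (p - 1)`. [folklore] -/
theorem writhe_eq : (torusGauss p q).writhe = ((q * (p - 1) : ℕ) : ℤ) := by
  rw [GaussDiagram.writhe_eq_sub, nPlus_eq, nMinus_eq]; simp

/-- The Seifert rule for the (positive) torus diagram: the `0`-smoothing is Seifert's at every
chord. [folklore] -/
@[simp] theorem isSeifert_eq (σ : (torusGauss p q).State) (i : Fin (torusGauss p q).n) :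
    (torusGauss p q).isSeifert σ i = !(σ i) := by
  cases h : σ i <;> simp [GaussDiagram.isSeifert, h]


/-! ## The successor of a marked point in block coordinates -/

variable {p q}

/-- The cyclic successor of a marked point, as a number. [folklore] -/
theorem succPt_val (x : Fin (2 * (q * (p - 1)))) :
    ((torusGauss p q).succPt x).val = (x.val + 1) % (2 * (q * (p - 1))) := rfl

/-- Successor inside a block. [folklore] -/
theorem succPt_pos_of_lt (b : Fin (2 * q)) (c c' : Fin (p - 1)) (h : c'.val = c.val + 1) :
    (torusGauss p q).succPt (pos p q b c) = pos p q b c' := by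
  apply Fin.ext
  have hlt := (pos p q b c').isLt
  rw [pos_val, h] at hlt
  rw [succPt_val, pos_val, pos_val, h, Nat.mod_eq_of_lt (by omega)]
  omega

/-- Successor of the last point of an even block: the first point of the next (odd) block.
[folklore] -/
theorem succPt_pos_ublk_last (β : Fin q) (c c₀ : Fin (p - 1)) (h : c.val + 1 = p - 1)
    (h₀ : c₀.val = 0) : (torusGauss p q).succPt (pos p q (ublk β) c) = pos p q (oblk β) c₀ := by
  apply Fin.ext
  have hlt := (pos p q (oblk β) c₀).isLt
  rw [pos_val, h₀] at hlt
  have e : (p - 1) * (oblk β : ℕ) = (p - 1) * (ublk β : ℕ) + (p - 1) := by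
    simp only [oblk_val, ublk_val]; ring
  rw [succPt_val, pos_val, pos_val, h₀, Nat.mod_eq_of_lt (by omega)]
  omega

/-- The cyclic successor of a half-block index. [folklore] -/
def hsucc (β : Fin q) : Fin q := ⟨(β + 1) % q, Nat.mod_lt _ β.pos⟩

/-- The value of `hsucc β` is `(β + 1) mod q`. [folklore] -/
@[simp] theorem hsucc_val (β : Fin q) : (hsucc β).val = (β + 1) % q := rfl

/-- `hsucc` in `ZMod q`. [folklore] -/
theorem cast_hsucc (β : Fin q) : ((hsucc β : ℕ) : ZMod q) = (β : ℕ) + 1 := by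
  simp [hsucc, ZMod.natCast_mod]

/-- Successor of the last point of an odd block: the first point of the next (even) block,
cyclically. [folklore] -/
theorem succPt_pos_oblk_last (β : Fin q) (c c₀ : Fin (p - 1)) (h : c.val + 1 = p - 1)
    (h₀ : c₀.val = 0) :
    (torusGauss p q).succPt (pos p q (oblk β) c) = pos p q (ublk (hsucc β)) c₀ := by
  apply Fin.ext
  have e : (p - 1) * (2 * (β : ℕ) + 1) + c + 1 = (2 * (p - 1)) * (β + 1) := by
    calc (p - 1) * (2 * (β : ℕ) + 1) + c + 1 = (p - 1) * (2 * (β : ℕ) + 1) + (p - 1) := by omega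
      _ = (2 * (p - 1)) * (β + 1) := by ring
  rw [succPt_val, pos_val, pos_val, h₀, oblk_val, ublk_val, hsucc_val, add_zero, e,
    show 2 * (q * (p - 1)) = (2 * (p - 1)) * q by ring, Nat.mul_mod_mul_left]
  ring

/-! ## Levels (Seifert circles) and the successor arc map -/

/-- The **level** of the arc leaving the marked point with position number `v`: in an even
block `2β` at offset `c` it is `c + 1`, in an odd block at offset `c` it is `p - 2 - c`.
Geometrically: the radial rank (from outside) of the arc in the closed-braid picture; the
`p` levels `0, …, p - 1` are the Seifert circles (`lvl_nxt`, `exists_iterate_nxt`). [folklore] -/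
def lvl (p v : ℕ) : ℕ := if v / (p - 1) % 2 = 0 then v % (p - 1) + 1 else p - 2 - v % (p - 1)

/-- The level of the arc leaving an even-block point at offset `c` is `c + 1`. [folklore] -/
theorem lvl_pos_ublk (β : Fin q) (c : Fin (p - 1)) : lvl p (pos p q (ublk β) c).val = c + 1 := by
  rw [lvl, pos_div, pos_mod, if_pos (by simp)]

/-- The level of the arc leaving an odd-block point at offset `c` is `p - 2 - c`. [folklore] -/
theorem lvl_pos_oblk (β : Fin q) (c : Fin (p - 1)) :
    lvl p (pos p q (oblk β) c).val = p - 2 - c := by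
  rw [lvl, pos_div, pos_mod, if_neg (by simp)]

/-- Levels are `≤ p - 1`. [folklore] -/
theorem lvl_le (x : Fin (2 * (q * (p - 1)))) : lvl p x.val ≤ p - 1 := by
  have hc := (off x).isLt
  rw [← pos_blk_off x]
  rcases eq_ublk_or_eq_oblk (blk x) with h | h <;> rw [h]
  · rw [lvl_pos_ublk]; omega
  · rw [lvl_pos_oblk]; omega

/-- The **successor arc** along the Seifert smoothing: the arc leaving `x` ends at `x + 1` and is
glued there (Seifert rule, all chords positive) to the arc leaving the partner of `x + 1`.
[folklore] -/
def nxt (p q : ℕ) (x : Fin (2 * (q * (p - 1)))) : Fin (2 * (q * (p - 1))) :=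
  (torusGauss p q).partner ((torusGauss p q).succPt x)

/-- Unfolding lemma for `nxt`. [folklore] -/
theorem nxt_eq (x : Fin (2 * (q * (p - 1)))) :
    nxt p q x = (torusGauss p q).partner ((torusGauss p q).succPt x) := rfl

/-- `nxt` from an even block, not at its end. [folklore] -/
theorem nxt_pos_ublk_of_lt (β : Fin q) (c c' : Fin (p - 1)) (h : c'.val = c.val + 1) :
    nxt p q (pos p q (ublk β) c) = pos p q (oblk (oidx p q β c')) (Fin.rev c') := by
  rw [nxt, succPt_pos_of_lt _ _ _ h, pos_ublk, partner_uPos, oPos]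

/-- `nxt` from the end of an even block. [folklore] -/
theorem nxt_pos_ublk_last (β : Fin q) (c : Fin (p - 1)) (h : c.val + 1 = p - 1) :
    nxt p q (pos p q (ublk β) c) = pos p q (ublk (uidx p q β c)) c := by
  have hr : Fin.rev (Fin.rev c) = c := Fin.rev_rev c
  have h₀ : (Fin.rev c).val = 0 := by rw [Fin.val_rev]; omega
  rw [nxt, succPt_pos_ublk_last β c (Fin.rev c) h h₀, pos_oblk, partner_oPos, uPos, hr]

/-- `nxt` from an odd block, not at its end. [folklore] -/
theorem nxt_pos_oblk_of_lt (β : Fin q) (c c' : Fin (p - 1)) (h : c'.val = c.val + 1) :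
    nxt p q (pos p q (oblk β) c) = pos p q (ublk (uidx p q β (Fin.rev c'))) (Fin.rev c') := by
  rw [nxt, succPt_pos_of_lt _ _ _ h, pos_oblk, partner_oPos, uPos]

/-- `nxt` from the end of an odd block. [folklore] -/
theorem nxt_pos_oblk_last (β : Fin q) (c : Fin (p - 1)) (h : c.val + 1 = p - 1) :
    nxt p q (pos p q (oblk β) c) = pos p q (oblk (oidx p q (hsucc β) (Fin.rev c))) c := by
  have hr : Fin.rev (Fin.rev c) = c := Fin.rev_rev c
  have h₀ : (Fin.rev c).val = 0 := by rw [Fin.val_rev]; omega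
  rw [nxt, succPt_pos_oblk_last β c (Fin.rev c) h h₀, pos_ublk, partner_uPos, oPos, hr]

/-- Case analysis on a marked point: block parity and whether it ends its block. [folklore] -/
theorem pos_cases (x : Fin (2 * (q * (p - 1)))) :
    (∃ β c c' : _, (c' : Fin (p - 1)).val = (c : Fin (p - 1)).val + 1 ∧
        (x = pos p q (ublk β) c ∨ x = pos p q (oblk β) c)) ∨
      (∃ β c, (c : Fin (p - 1)).val + 1 = p - 1 ∧
        (x = pos p q (ublk β) c ∨ x = pos p q (oblk β) c)) := by
  have hc := (off x).isLt
  by_cases h : (off x).val + 1 < p - 1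
  · refine Or.inl ⟨hblk (blk x), off x, ⟨_, h⟩, rfl, ?_⟩
    rcases eq_ublk_or_eq_oblk (blk x) with h' | h'
    · left; conv_lhs => rw [← pos_blk_off x, h']
    · right; conv_lhs => rw [← pos_blk_off x, h']
  · refine Or.inr ⟨hblk (blk x), off x, by omega, ?_⟩
    rcases eq_ublk_or_eq_oblk (blk x) with h' | h'
    · left; conv_lhs => rw [← pos_blk_off x, h']
    · right; conv_lhs => rw [← pos_blk_off x, h']

/-- **The level is invariant under the successor arc map**: `nxt` walks along a Seifert circle.
[folklore] -/
theorem lvl_nxt (x : Fin (2 * (q * (p - 1)))) : lvl p (nxt p q x).val = lvl p x.val := by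
  rcases pos_cases x with ⟨β, c, c', hc, rfl | rfl⟩ | ⟨β, c, hc, rfl | rfl⟩
  · rw [nxt_pos_ublk_of_lt β c c' hc, lvl_pos_oblk, lvl_pos_ublk, Fin.val_rev]; omega
  · rw [nxt_pos_oblk_of_lt β c c' hc, lvl_pos_ublk, lvl_pos_oblk, Fin.val_rev]; omega
  · rw [nxt_pos_ublk_last β c hc, lvl_pos_ublk, lvl_pos_ublk]
  · rw [nxt_pos_oblk_last β c hc, lvl_pos_oblk, lvl_pos_oblk]

/-- Level invariance along iterates of `nxt`. [folklore] -/
theorem lvl_iterate_nxt (k : ℕ) (x : Fin (2 * (q * (p - 1)))) :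
    lvl p ((nxt p q)^[k] x).val = lvl p x.val := by
  induction k with
  | zero => rfl
  | succ k ih => rw [Function.iterate_succ_apply', lvl_nxt, ih]

/-- The levels seen at the two ends of a chord: the arc entering the under-passage `uPos β c`
is `nxt`-followed by the arc leaving the over-passage, and has level `c`; the arc leaving the
under-passage has level `c + 1`. [folklore] -/
theorem lvl_uPos (β : Fin q) (c : Fin (p - 1)) : lvl p (uPos p q β c).val = c + 1 :=
  lvl_pos_ublk β c

/-- The arc leaving the over-passage of the chord `(β, c)` has level `c`. [folklore] -/
theorem lvl_oPos (β : Fin q) (c : Fin (p - 1)) : lvl p (oPos p q β c).val = c := by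
  rw [oPos, lvl_pos_oblk, Fin.val_rev]; omega

/-- `nxt (x - 1) = partner x`. [folklore] -/
theorem nxt_predPt (x : Fin (2 * (q * (p - 1)))) :
    nxt p q ((torusGauss p q).predPt x) = (torusGauss p q).partner x := by
  rw [nxt, GaussDiagram.succPt_predPt]

/-- The arc entering a marked point `x` has the level of the arc leaving the partner of `x`
(they are glued by the Seifert smoothing). [folklore] -/
theorem lvl_predPt (x : Fin (2 * (q * (p - 1)))) :
    lvl p ((torusGauss p q).predPt x).val = lvl p ((torusGauss p q).partner x).val := by
  rw [← nxt_predPt, lvl_nxt]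

/-- The arc entering the under-passage of the chord `(β, c)` has level `c`. [folklore] -/
theorem lvl_predPt_uPos (β : Fin q) (c : Fin (p - 1)) :
    lvl p ((torusGauss p q).predPt (uPos p q β c)).val = c := by
  rw [lvl_predPt, partner_uPos, lvl_oPos]

/-- The arc entering the over-passage of the chord `(β, c)` has level `c + 1`. [folklore] -/
theorem lvl_predPt_oPos (β : Fin q) (c : Fin (p - 1)) :
    lvl p ((torusGauss p q).predPt (oPos p q β c)).val = c + 1 := by
  rw [lvl_predPt, partner_oPos, lvl_uPos]


/-! ## One lap along a Seifert circle shifts the block by `p⁻¹` -/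

/-- The shift `β ↦ β + p⁻¹ (mod q)` of half-block indices. [folklore] -/
def hshift (p q : ℕ) (β : Fin q) : Fin q := ⟨(β + pinv p q) % q, Nat.mod_lt _ β.pos⟩

/-- `hshift` in `ZMod q`. [folklore] -/
theorem cast_hshift (β : Fin q) : ((hshift p q β : ℕ) : ZMod q) = (β : ℕ) + (pinv p q : ℕ) := by
  simp [hshift, ZMod.natCast_mod]

/-- Iterates of `hshift` in `ZMod q`. [folklore] -/
theorem cast_iterate_hshift (m : ℕ) (β : Fin q) :
    (((hshift p q)^[m] β : Fin q) : ZMod q) = (β : ℕ) + m * (pinv p q : ℕ) := by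
  induction m with
  | zero => simp
  | succ m ih => rw [Function.iterate_succ_apply', cast_hshift, ih]; push_cast; ring

/-- Every half-block index is reached from every other by iterating `hshift` (`p p⁻¹ ≡ 1`).
[folklore] -/
theorem exists_iterate_hshift (hpq : p.Coprime q) (β β' : Fin q) :
    ∃ m, (hshift p q)^[m] β = β' := by
  haveI : NeZero q := ⟨(Nat.pos_iff_ne_zero).1 β.pos⟩
  refine ⟨p * (((β' : ℕ) : ZMod q) - (β : ℕ)).val, fin_eq_of_cast_eq ?_⟩
  rw [cast_iterate_hshift, Nat.cast_mul, mul_comm (p : ZMod q), mul_assoc,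
    natCast_mul_pinv β.pos hpq, mul_one, ZMod.natCast_zmod_val]
  ring

/-- The **block shift** of a marked point: same parity of block, same offset, half-block index
shifted by `p⁻¹ (mod q)`. One lap along a Seifert circle realises it
(`exists_iterate_nxt_eq_shiftPos`).
[folklore] -/
def shiftPos (p q : ℕ) (x : Fin (2 * (q * (p - 1)))) : Fin (2 * (q * (p - 1))) :=
  if (blk x).val % 2 = 0 then pos p q (ublk (hshift p q (hblk (blk x)))) (off x)
  else pos p q (oblk (hshift p q (hblk (blk x)))) (off x)

/-- The block shift of an even-block point. [folklore] -/
theorem shiftPos_pos_ublk (β : Fin q) (c : Fin (p - 1)) :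
    shiftPos p q (pos p q (ublk β) c) = pos p q (ublk (hshift p q β)) c := by
  simp [shiftPos]

/-- The block shift of an odd-block point. [folklore] -/
theorem shiftPos_pos_oblk (β : Fin q) (c : Fin (p - 1)) :
    shiftPos p q (pos p q (oblk β) c) = pos p q (oblk (hshift p q β)) c := by
  simp [shiftPos]

/-- Iterated block shifts of an even-block point. [folklore] -/
theorem iterate_shiftPos_pos_ublk (m : ℕ) (β : Fin q) (c : Fin (p - 1)) :
    (shiftPos p q)^[m] (pos p q (ublk β) c) = pos p q (ublk ((hshift p q)^[m] β)) c := by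
  induction m with
  | zero => rfl
  | succ m ih => rw [Function.iterate_succ_apply', ih, shiftPos_pos_ublk,
      Function.iterate_succ_apply']

/-- Iterated block shifts of an odd-block point. [folklore] -/
theorem iterate_shiftPos_pos_oblk (m : ℕ) (β : Fin q) (c : Fin (p - 1)) :
    (shiftPos p q)^[m] (pos p q (oblk β) c) = pos p q (oblk ((hshift p q)^[m] β)) c := by
  induction m with
  | zero => rfl
  | succ m ih => rw [Function.iterate_succ_apply', ih, shiftPos_pos_oblk,
      Function.iterate_succ_apply']

/-- **One lap.** From every arc, one or two steps of `nxt` lead to the block-shifted arc: two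
steps for the middle levels `1, …, p - 2` (even block → odd block → even block), one step for
the innermost level `p - 1` and the outermost level `0`. The innermost case uses
`p p⁻¹ ≡ 1 (mod q)`. [folklore] -/
theorem exists_iterate_nxt_eq_shiftPos (hpq : p.Coprime q) (x : Fin (2 * (q * (p - 1)))) :
    ∃ k, (nxt p q)^[k] x = shiftPos p q x := by
  rcases pos_cases x with ⟨β, c, c', hc, rfl | rfl⟩ | ⟨β, c, hc, rfl | rfl⟩
  · -- even block, not last: two steps
    refine ⟨2, ?_⟩
    have hc' : (Fin.rev c).val = (Fin.rev c').val + 1 := by simp only [Fin.val_rev]; omega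
    rw [Function.iterate_succ_apply', Function.iterate_one, nxt_pos_ublk_of_lt β c c' hc,
      nxt_pos_oblk_of_lt _ (Fin.rev c') (Fin.rev c) hc', Fin.rev_rev, shiftPos_pos_ublk]
    congr 2
    apply fin_eq_of_cast_eq
    rw [cast_uidx, cast_oidx, cast_hshift, hc]
    push_cast
    ring
  · -- odd block, not last: two steps
    refine ⟨2, ?_⟩
    have hc' : (Fin.rev c).val = (Fin.rev c').val + 1 := by simp only [Fin.val_rev]; omega
    rw [Function.iterate_succ_apply', Function.iterate_one, nxt_pos_oblk_of_lt β c c' hc,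
      nxt_pos_ublk_of_lt _ (Fin.rev c') (Fin.rev c) hc', Fin.rev_rev, shiftPos_pos_oblk]
    congr 2
    apply fin_eq_of_cast_eq
    rw [cast_oidx, cast_uidx, cast_hshift, hc']
    push_cast
    ring
  · -- even block, last (innermost level): one step, uses coprimality
    refine ⟨1, ?_⟩
    rw [Function.iterate_one, nxt_pos_ublk_last β c hc, shiftPos_pos_ublk]
    congr 2
    apply fin_eq_of_cast_eq
    have h1 : 1 ≤ p := by omega
    have h2 : ((c : ℕ) : ZMod q) + 1 = (p : ZMod q) - 1 := by
      have h3 : (((c : ℕ) + 1 + 1 : ℕ) : ZMod q) = (p : ZMod q) :=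
        congrArg (Nat.cast : ℕ → ZMod q) (by omega)
      rw [eq_sub_iff_add_eq, ← h3]; push_cast; ring
    rw [cast_uidx, cast_hshift, h2, sub_mul, natCast_mul_pinv β.pos hpq]
    ring
  · -- odd block, last (outermost level): one step
    refine ⟨1, ?_⟩
    have h0 : (Fin.rev c).val = 0 := by rw [Fin.val_rev]; omega
    rw [Function.iterate_one, nxt_pos_oblk_last β c hc, shiftPos_pos_oblk]
    congr 2
    apply fin_eq_of_cast_eq
    rw [cast_oidx, cast_hshift, cast_hsucc, h0]
    push_cast
    ring

/-- Any number of laps is realised by iterating `nxt`. [folklore] -/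
theorem exists_iterate_nxt_eq_iterate_shiftPos (hpq : p.Coprime q) (m : ℕ)
    (x : Fin (2 * (q * (p - 1)))) : ∃ k, (nxt p q)^[k] x = (shiftPos p q)^[m] x := by
  induction m with
  | zero => exact ⟨0, rfl⟩
  | succ m ih =>
    obtain ⟨k₁, hk₁⟩ := ih
    obtain ⟨k₂, hk₂⟩ := exists_iterate_nxt_eq_shiftPos hpq ((shiftPos p q)^[m] x)
    refine ⟨k₂ + k₁, ?_⟩
    rw [Function.iterate_add_apply, hk₁, hk₂, Function.iterate_succ_apply']

/-- All arcs of an even block parity and a fixed offset lie on one `nxt`-orbit. [folklore] -/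
theorem exists_iterate_nxt_ublk (hpq : p.Coprime q) (β β' : Fin q) (c : Fin (p - 1)) :
    ∃ k, (nxt p q)^[k] (pos p q (ublk β) c) = pos p q (ublk β') c := by
  obtain ⟨m, hm⟩ := exists_iterate_hshift hpq β β'
  obtain ⟨k, hk⟩ := exists_iterate_nxt_eq_iterate_shiftPos hpq m (pos p q (ublk β) c)
  exact ⟨k, by rw [hk, iterate_shiftPos_pos_ublk, hm]⟩

/-- All arcs of an odd block parity and a fixed offset lie on one `nxt`-orbit. [folklore] -/
theorem exists_iterate_nxt_oblk (hpq : p.Coprime q) (β β' : Fin q) (c : Fin (p - 1)) :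
    ∃ k, (nxt p q)^[k] (pos p q (oblk β) c) = pos p q (oblk β') c := by
  obtain ⟨m, hm⟩ := exists_iterate_hshift hpq β β'
  obtain ⟨k, hk⟩ := exists_iterate_nxt_eq_iterate_shiftPos hpq m (pos p q (oblk β) c)
  exact ⟨k, by rw [hk, iterate_shiftPos_pos_oblk, hm]⟩

/-- **Arcs of the same level lie on one `nxt`-orbit** (for coprime `p, q`): the `p` levels are
exactly the Seifert circles of the torus diagram. [folklore] -/
theorem exists_iterate_nxt (hpq : p.Coprime q) {x y : Fin (2 * (q * (p - 1)))}
    (h : lvl p x.val = lvl p y.val) : ∃ k, (nxt p q)^[k] x = y := by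
  have hx := (off x).isLt
  have hy := (off y).isLt
  rw [← pos_blk_off x, ← pos_blk_off y] at h ⊢
  rcases eq_ublk_or_eq_oblk (blk x) with h₁ | h₁ <;>
    rcases eq_ublk_or_eq_oblk (blk y) with h₂ | h₂ <;> rw [h₁, h₂] at h ⊢
  · rw [lvl_pos_ublk, lvl_pos_ublk] at h
    rw [show off y = off x from Fin.ext (by omega)]
    exact exists_iterate_nxt_ublk hpq _ _ _
  · rw [lvl_pos_ublk, lvl_pos_oblk] at h
    have hlt : (off x).val + 1 < p - 1 := by omega
    obtain ⟨k, hk⟩ := exists_iterate_nxt_oblk hpq (oidx p q (hblk (blk x)) ⟨_, hlt⟩)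
      (hblk (blk y)) (off y)
    refine ⟨k + 1, ?_⟩
    rw [Function.iterate_add_apply, Function.iterate_one,
      nxt_pos_ublk_of_lt (hblk (blk x)) (off x) ⟨_, hlt⟩ rfl, ← hk]
    congr 2
    exact Fin.ext (by simp only [Fin.val_rev]; omega)
  · rw [lvl_pos_oblk, lvl_pos_ublk] at h
    have hlt : (off x).val + 1 < p - 1 := by omega
    obtain ⟨k, hk⟩ := exists_iterate_nxt_ublk hpq (uidx p q (hblk (blk x)) (Fin.rev ⟨_, hlt⟩))
      (hblk (blk y)) (off y)
    refine ⟨k + 1, ?_⟩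
    rw [Function.iterate_add_apply, Function.iterate_one,
      nxt_pos_oblk_of_lt (hblk (blk x)) (off x) ⟨_, hlt⟩ rfl, ← hk]
    have hr : Fin.rev (⟨(off x).val + 1, hlt⟩ : Fin (p - 1)) = off y :=
      Fin.ext (by simp only [Fin.val_rev]; omega)
    rw [hr]
  · rw [lvl_pos_oblk, lvl_pos_oblk] at h
    rw [show off y = off x from Fin.ext (by omega)]
    exact exists_iterate_nxt_oblk hpq _ _ _

/-! ## From orbits to state circles -/

section Reach

variable (p q)

/-- Local notation for this section: `𝕋` is the torus diagram `torusGauss p q`. -/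
local notation "𝕋" => torusGauss p q

/-- One step of `nxt` is a gluing of the state `σ` whenever `σ` takes the `0`-smoothing at the
chord through `x + 1` (Seifert rule for a positive chord). [folklore] -/
theorem reachable_arcOut_nxt (σ : (𝕋).State) (x : Fin (2 * (q * (p - 1))))
    (hσ : σ ((𝕋).chordOf ((𝕋).succPt x)) = false) :
    ((𝕋).stateGraph σ).Reachable ((𝕋).arcOut x) ((𝕋).arcOut (nxt p q x)) := by
  have h := (𝕋).reachable_endArc_endGlue σ ((𝕋).succPt x, false)
  have h1 : (𝕋).endArc ((𝕋).succPt x, false) = (𝕋).arcOut x := (𝕋).arcIn_succPt x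
  have h2 : (𝕋).endGlue σ ((𝕋).succPt x, false) = ((𝕋).partner ((𝕋).succPt x), true) := by
    simp [GaussDiagram.endGlue, hσ]
  rwa [h1, h2] at h

/-- Iterated version of `reachable_arcOut_nxt`. [folklore] -/
theorem reachable_arcOut_iterate_nxt (σ : (𝕋).State) (x : Fin (2 * (q * (p - 1)))) (k : ℕ)
    (hσ : ∀ j < k, σ ((𝕋).chordOf ((𝕋).succPt ((nxt p q)^[j] x))) = false) :
    ((𝕋).stateGraph σ).Reachable ((𝕋).arcOut x) ((𝕋).arcOut ((nxt p q)^[k] x)) := by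
  induction k with
  | zero => rfl
  | succ k ih =>
    rw [Function.iterate_succ_apply']
    exact (ih fun j hj ↦ hσ j (by omega)).trans
      (reachable_arcOut_nxt p q σ _ (hσ k (by omega)))

/-- For `q (p - 1) ≥ 1` every arc is the arc leaving some marked point. [folklore] -/
theorem arcOut_surjective (hn : 0 < q * (p - 1)) (a : (𝕋).Arc) :
    ∃ x : Fin (2 * (q * (p - 1))), (𝕋).arcOut x = a :=
  ⟨⟨a.val, lt_of_lt_of_le a.isLt (by simp [GaussDiagram.arcCount]; omega)⟩, rfl⟩

/-- The value of an arc is a position number (for `q (p - 1) ≥ 1`). [folklore] -/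
theorem arc_val_lt (hn : 0 < q * (p - 1)) (a : (𝕋).Arc) : a.val < 2 * (q * (p - 1)) :=
  lt_of_lt_of_le a.isLt (by simp [GaussDiagram.arcCount]; omega)

/-- The arc leaving `x` has number `x`. [folklore] -/
@[simp] theorem arcOut_val (x : Fin (2 * (q * (p - 1)))) : ((𝕋).arcOut x).val = x.val := rfl

/-- The arc entering `x` is the arc leaving `x - 1`. [folklore] -/
theorem arcIn_eq (x : Fin (2 * (q * (p - 1)))) : (𝕋).arcIn x = (𝕋).arcOut ((𝕋).predPt x) := rfl

/-- **Same level ⇒ same Seifert circle**: in the all-`0` state (the Seifert state of the positive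
torus diagram) two arcs of the same level lie on the same state circle. [folklore] -/
theorem reachable_seifert_of_lvl_eq (hpq : p.Coprime q) {x y : Fin (2 * (q * (p - 1)))}
    (h : lvl p x.val = lvl p y.val) :
    ((𝕋).stateGraph fun _ ↦ false).Reachable ((𝕋).arcOut x) ((𝕋).arcOut y) := by
  obtain ⟨k, rfl⟩ := exists_iterate_nxt hpq h
  exact reachable_arcOut_iterate_nxt p q _ x k fun _ _ ↦ rfl


/-! ## Chords: half-block and offset -/

/-- The half-block index `β` of the chord `j ↔ (β, c)`. [folklore] -/
def cblk (j : Fin (𝕋).n) : Fin q := (finProdFinEquiv.symm j).1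

/-- The offset `c` of the chord `j ↔ (β, c)`; the chord joins the levels `c` and `c + 1`.
[folklore] -/
def coff (j : Fin (𝕋).n) : Fin (p - 1) := (finProdFinEquiv.symm j).2

/-- The over-passage of a chord in block coordinates. [folklore] -/
theorem overPos_eq_oPos (j : Fin (𝕋).n) : (𝕋).overPos j = oPos p q (cblk p q j) (coff p q j) :=
  rfl

/-- The under-passage of a chord in block coordinates. [folklore] -/
theorem underPos_eq_uPos (j : Fin (𝕋).n) :
    (𝕋).underPos j = uPos p q (cblk p q j) (coff p q j) := rfl

/-- The half-block index of `chord β c` is `β`. [folklore] -/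
@[simp] theorem cblk_chord (β : Fin q) (c : Fin (p - 1)) : cblk p q (chord p q β c) = β := by
  simp [cblk, chord]

/-- The offset of `chord β c` is `c`. [folklore] -/
@[simp] theorem coff_chord (β : Fin q) (c : Fin (p - 1)) : coff p q (chord p q β c) = c := by
  simp [coff, chord]

/-- A chord is determined by its half-block index and offset. [folklore] -/
theorem chord_cblk_coff (j : Fin (𝕋).n) : chord p q (cblk p q j) (coff p q j) = j := by
  rw [chord, cblk, coff, Prod.mk.eta, Equiv.apply_symm_apply]

/-- Every marked point is the under- or the over-passage of a chord `(β, c)`. [folklore] -/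
theorem eq_uPos_or_eq_oPos (z : Fin (2 * (q * (p - 1)))) :
    ∃ β c, z = uPos p q β c ∨ z = oPos p q β c := by
  obtain ⟨j, h | h⟩ := (𝕋).exists_chord z
  · exact ⟨cblk p q j, coff p q j, Or.inr h.symm⟩
  · exact ⟨cblk p q j, coff p q j, Or.inl h.symm⟩

/-- The two ends of a chord lie on different levels (`c + 1` and `c`). [folklore] -/
theorem lvl_partner_ne (z : Fin (2 * (q * (p - 1)))) :
    lvl p ((𝕋).partner z).val ≠ lvl p z.val := by
  obtain ⟨β, c, rfl | rfl⟩ := eq_uPos_or_eq_oPos p q z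
  · rw [partner_uPos, lvl_oPos, lvl_uPos]; omega
  · rw [partner_oPos, lvl_oPos, lvl_uPos]; omega

/-- Two marked points on the same chord are equal or partners. [folklore] -/
theorem eq_or_eq_partner_of_chordOf_eq {a b : Fin (2 * (q * (p - 1)))}
    (h : (𝕋).chordOf a = (𝕋).chordOf b) : a = b ∨ a = (𝕋).partner b := by
  rcases (𝕋).chordOf_spec a with ha | ha <;> rcases (𝕋).chordOf_spec b with hb | hb
  · left; rw [← ha, ← hb, h]
  · right; rw [← ha, ← hb, GaussDiagram.partner_underPos, h]
  · right; rw [← ha, ← hb, GaussDiagram.partner_overPos, h]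
  · left; rw [← ha, ← hb, h]

/-! ## Levels classify the state circles of the Seifert state and of its one-chord flips -/

/-- **Adjacent arcs have the same level, except across a non-Seifert gluing.** In any state
`σ`, two arcs glued by a Seifert smoothing have the same level; two arcs glued by the
non-Seifert smoothing at a chord `j` (`σ j = 1`) both have level `coff j` or `coff j + 1`.
[folklore] -/
theorem lvl_eq_or_of_adj (σ : (𝕋).State) {a b : (𝕋).Arc} (h : ((𝕋).stateGraph σ).Adj a b) :
    lvl p a.val = lvl p b.val ∨ ∃ j, σ j = true ∧
      (lvl p a.val = coff p q j ∨ lvl p a.val = coff p q j + 1) ∧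
      (lvl p b.val = coff p q j ∨ lvl p b.val = coff p q j + 1) := by
  -- the asymmetric reconnection relation implies the (symmetric) conclusion
  have key : ∀ a b : (𝕋).Arc, (𝕋).stateAdj σ a b →
      lvl p a.val = lvl p b.val ∨ ∃ j, σ j = true ∧
        (lvl p a.val = coff p q j ∨ lvl p a.val = coff p q j + 1) ∧
        (lvl p b.val = coff p q j ∨ lvl p b.val = coff p q j + 1) := by
    rintro a b ⟨-, x, ⟨hs, h⟩ | ⟨hs, h⟩⟩
    · -- Seifert gluing: `arcIn x ~ arcOut (partner x)`
      left
      have e : lvl p ((𝕋).arcIn x).val = lvl p ((𝕋).arcOut ((𝕋).partner x)).val :=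
        lvl_predPt x
      rcases h with ⟨rfl, rfl⟩ | ⟨rfl, rfl⟩
      · exact e
      · exact e.symm
    · -- non-Seifert gluing at the chord `j` through `x`
      right
      rw [isSeifert_eq, Bool.not_eq_false'] at hs
      refine ⟨(𝕋).chordOf x, hs, ?_⟩
      obtain ⟨β, c, rfl | rfl⟩ := eq_uPos_or_eq_oPos p q x
      · rw [chordOf_uPos, coff_chord]
        have h1 : lvl p ((𝕋).arcIn (uPos p q β c)).val = c := lvl_predPt_uPos β c
        have h2 : lvl p ((𝕋).arcIn ((𝕋).partner (uPos p q β c))).val = c + 1 := by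
          rw [partner_uPos]; exact lvl_predPt_oPos β c
        have h3 : lvl p ((𝕋).arcOut (uPos p q β c)).val = c + 1 := lvl_uPos β c
        have h4 : lvl p ((𝕋).arcOut ((𝕋).partner (uPos p q β c))).val = c := by
          rw [partner_uPos]; exact lvl_oPos β c
        rcases h with ⟨rfl, rfl⟩ | ⟨rfl, rfl⟩
        · exact ⟨Or.inl h1, Or.inr h2⟩
        · exact ⟨Or.inr h3, Or.inl h4⟩
      · rw [chordOf_oPos, coff_chord]
        have h1 : lvl p ((𝕋).arcIn (oPos p q β c)).val = c + 1 := lvl_predPt_oPos β c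
        have h2 : lvl p ((𝕋).arcIn ((𝕋).partner (oPos p q β c))).val = c := by
          rw [partner_oPos]; exact lvl_predPt_uPos β c
        have h3 : lvl p ((𝕋).arcOut (oPos p q β c)).val = c := lvl_oPos β c
        have h4 : lvl p ((𝕋).arcOut ((𝕋).partner (oPos p q β c))).val = c + 1 := by
          rw [partner_oPos]; exact lvl_uPos β c
        rcases h with ⟨rfl, rfl⟩ | ⟨rfl, rfl⟩
        · exact ⟨Or.inr h1, Or.inl h2⟩
        · exact ⟨Or.inl h3, Or.inr h4⟩
  rw [GaussDiagram.stateGraph, SimpleGraph.fromRel_adj] at h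
  rcases h.2 with h | h
  · exact key a b h
  · rcases key b a h with h | ⟨j, hj, h1, h2⟩
    · exact Or.inl h.symm
    · exact Or.inr ⟨j, hj, h2, h1⟩

/-- In the Seifert state (all chords `0`-smoothed) reachable arcs have the same level.
[folklore] -/
theorem lvl_eq_of_reachable_seifert {a b : (𝕋).Arc}
    (h : ((𝕋).stateGraph fun _ ↦ false).Reachable a b) : lvl p a.val = lvl p b.val := by
  rw [SimpleGraph.reachable_iff_reflTransGen] at h
  induction h with
  | refl => rfl
  | tail _ hab ih =>
    rcases lvl_eq_or_of_adj p q _ hab with h | ⟨j, hj, -⟩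
    · exact ih.trans h
    · exact absurd hj (by simp)

/-- **The state circles of the Seifert state are the levels**: two arcs lie on the same circle of
the all-`0` resolution of the torus diagram iff they have the same level (coprime `p, q`,
`q (p - 1) ≥ 1`). [folklore] -/
theorem reachable_seifert_iff (hpq : p.Coprime q) (hn : 0 < q * (p - 1)) {a b : (𝕋).Arc} :
    ((𝕋).stateGraph fun _ ↦ false).Reachable a b ↔ lvl p a.val = lvl p b.val := by
  refine ⟨lvl_eq_of_reachable_seifert p q, fun h ↦ ?_⟩
  obtain ⟨x, rfl⟩ := arcOut_surjective p q hn a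
  obtain ⟨y, rfl⟩ := arcOut_surjective p q hn b
  exact reachable_seifert_of_lvl_eq p q hpq h

/-- Same circle of the Seifert state iff same level. [folklore] -/
theorem circleOf_seifert_eq_iff (hpq : p.Coprime q) (hn : 0 < q * (p - 1)) {a b : (𝕋).Arc} :
    (𝕋).circleOf (fun _ ↦ false) a = (𝕋).circleOf (fun _ ↦ false) b ↔
      lvl p a.val = lvl p b.val := by
  rw [GaussDiagram.circleOf, GaussDiagram.circleOf, SimpleGraph.ConnectedComponent.eq]
  exact reachable_seifert_iff p q hpq hn

/-- **Walking a level with one chord cut.** Let `σ` take the `0`-smoothing at every chord other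
than the chord through `z`. Then every arc of the level of the arc leaving `z` is reachable from
it in the state graph of `σ`: walk forward with `nxt`; the first return to the chord through `z`
would close up the circle at `z` itself, which a shortest walk never does. [folklore] -/
theorem reachable_of_lvl_eq_of_forall_ne (hpq : p.Coprime q) (σ : (𝕋).State)
    (z y : Fin (2 * (q * (p - 1)))) (hσ : ∀ j, j ≠ (𝕋).chordOf z → σ j = false)
    (h : lvl p z.val = lvl p y.val) :
    ((𝕋).stateGraph σ).Reachable ((𝕋).arcOut z) ((𝕋).arcOut y) := by
  classical
  have hex : ∃ k, (nxt p q)^[k] z = y := exists_iterate_nxt hpq h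
  rw [← Nat.find_spec hex]
  refine reachable_arcOut_iterate_nxt p q σ z _ fun j hj ↦ ?_
  by_contra hne
  have hc : (𝕋).chordOf ((𝕋).succPt ((nxt p q)^[j] z)) = (𝕋).chordOf z := by
    by_contra hc
    exact hne (hσ _ hc)
  rcases eq_or_eq_partner_of_chordOf_eq p q hc with h1 | h1
  · -- the walk re-enters `z` from `z - 1`: impossible, `z - 1` is on the other level
    have hw : (nxt p q)^[j] z = (𝕋).predPt z := by
      rw [← (𝕋).predPt_succPt ((nxt p q)^[j] z), h1]
    have := lvl_iterate_nxt j z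
    rw [hw, lvl_predPt] at this
    exact lvl_partner_ne p q z this
  · -- the walk reaches `partner z - 1`, whose successor arc is `z`: a shorter walk exists
    have hw : (nxt p q)^[j + 1] z = z := by
      rw [Function.iterate_succ_apply', nxt_eq, h1, GaussDiagram.partner_partner]
    have hk : (nxt p q)^[Nat.find hex - (j + 1)] z = y := by
      conv_rhs => rw [← Nat.find_spec hex]
      conv_rhs => rw [show Nat.find hex = Nat.find hex - (j + 1) + (j + 1) by omega,
        Function.iterate_add_apply, hw]
    exact Nat.find_min hex (by omega) hk

/-- The two strands at a chord are glued (out-arc to out-arc) after flipping that chord to the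
`1`-smoothing. [folklore] -/
theorem reachable_arcOut_partner_update (z : Fin (2 * (q * (p - 1)))) :
    ((𝕋).stateGraph (Function.update (fun _ ↦ false) ((𝕋).chordOf z) true)).Reachable
      ((𝕋).arcOut z) ((𝕋).arcOut ((𝕋).partner z)) := by
  have h := (𝕋).reachable_endArc_endGlue (Function.update (fun _ ↦ false) ((𝕋).chordOf z) true)
    (z, true)
  have h2 : (𝕋).endGlue (Function.update (fun _ ↦ false) ((𝕋).chordOf z) true) (z, true) =
      ((𝕋).partner z, true) := by
    simp [GaussDiagram.endGlue]
  rw [h2] at h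
  exact h

/-- **State circles after flipping one chord.** In the state of the torus diagram with the single
chord `(β, c)` flipped to the `1`-smoothing, two arcs lie on the same state circle iff they have
the same level or both have level in `{c, c + 1}`: the flip merges the Seifert circles `c` and
`c + 1` and leaves the others untouched. [folklore] -/
theorem reachable_update_iff (hpq : p.Coprime q) (hn : 0 < q * (p - 1)) (β : Fin q)
    (c : Fin (p - 1)) {a b : (𝕋).Arc} :
    ((𝕋).stateGraph (Function.update (fun _ ↦ false) (chord p q β c) true)).Reachable a b ↔
      lvl p a.val = lvl p b.val ∨
        ((lvl p a.val = c ∨ lvl p a.val = c + 1) ∧ (lvl p b.val = c ∨ lvl p b.val = c + 1)) := by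
  set σ : (𝕋).State := Function.update (fun _ ↦ false) (chord p q β c) true with hσ
  constructor
  · intro h
    rw [SimpleGraph.reachable_iff_reflTransGen] at h
    induction h with
    | refl => exact Or.inl rfl
    | tail _ hab ih =>
      rcases lvl_eq_or_of_adj p q σ hab with h | ⟨j, hj, h1, h2⟩
      · rw [← h]; exact ih
      · have hji : j = chord p q β c := by
          by_contra hne
          rw [hσ, Function.update_of_ne hne] at hj
          exact Bool.false_ne_true hj
        rw [hji, coff_chord] at h1 h2
        rcases ih with ih | ⟨ih, -⟩
        · exact Or.inr ⟨by rw [ih]; exact h1, h2⟩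
        · exact Or.inr ⟨ih, h2⟩
  · obtain ⟨x, rfl⟩ := arcOut_surjective p q hn a
    obtain ⟨y, rfl⟩ := arcOut_surjective p q hn b
    simp only [arcOut_val]
    -- the two ends of the flipped chord reach their whole levels, and each other
    have hu : ∀ w, lvl p w.val = c + 1 → ((𝕋).stateGraph σ).Reachable
        ((𝕋).arcOut (uPos p q β c)) ((𝕋).arcOut w) := fun w hw ↦
      reachable_of_lvl_eq_of_forall_ne p q hpq σ _ w
        (fun j hj ↦ by rw [hσ, Function.update_of_ne (by simpa using hj)])
        (by rw [lvl_uPos, hw])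
    have ho : ∀ w, lvl p w.val = c → ((𝕋).stateGraph σ).Reachable
        ((𝕋).arcOut (oPos p q β c)) ((𝕋).arcOut w) := fun w hw ↦
      reachable_of_lvl_eq_of_forall_ne p q hpq σ _ w
        (fun j hj ↦ by rw [hσ, Function.update_of_ne (by simpa using hj)])
        (by rw [lvl_oPos, hw])
    have huo : ((𝕋).stateGraph σ).Reachable ((𝕋).arcOut (uPos p q β c))
        ((𝕋).arcOut (oPos p q β c)) := by
      have := reachable_arcOut_partner_update p q (uPos p q β c)
      rwa [chordOf_uPos, partner_uPos] at this
    have hM : ∀ w, (lvl p w.val = c ∨ lvl p w.val = c + 1) → ((𝕋).stateGraph σ).Reachable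
        ((𝕋).arcOut (uPos p q β c)) ((𝕋).arcOut w) := fun w hw ↦ by
      rcases hw with hw | hw
      · exact huo.trans (ho w hw)
      · exact hu w hw
    rintro (h | ⟨hx, hy⟩)
    · by_cases hxM : lvl p x.val = c ∨ lvl p x.val = c + 1
      · exact (hM x hxM).symm.trans (hM y (h ▸ hxM))
      · -- an untouched level: the Seifert walk along it avoids the flipped chord
        obtain ⟨k, rfl⟩ := exists_iterate_nxt hpq h
        refine reachable_arcOut_iterate_nxt p q σ x k fun j _ ↦ ?_
        rw [hσ, Function.update_of_ne]
        intro hc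
        apply hxM
        rw [← lvl_iterate_nxt j x]
        rcases (𝕋).chordOf_spec ((𝕋).succPt ((nxt p q)^[j] x)) with h1 | h1 <;> rw [hc] at h1
        · rw [overPos_chord] at h1
          rw [show (nxt p q)^[j] x = (𝕋).predPt (oPos p q β c) by
            rw [← (𝕋).predPt_succPt ((nxt p q)^[j] x), ← h1], lvl_predPt_oPos]
          exact Or.inr rfl
        · rw [underPos_chord] at h1
          rw [show (nxt p q)^[j] x = (𝕋).predPt (uPos p q β c) by
            rw [← (𝕋).predPt_succPt ((nxt p q)^[j] x), ← h1], lvl_predPt_uPos]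
          exact Or.inl rfl
    · exact (hM x hx).symm.trans (hM y hy)

/-- Same circle after flipping the chord `(β, c)` iff same level or both levels in `{c, c+1}`.
[folklore] -/
theorem circleOf_update_eq_iff (hpq : p.Coprime q) (hn : 0 < q * (p - 1)) (β : Fin q)
    (c : Fin (p - 1)) {a b : (𝕋).Arc} :
    (𝕋).circleOf (Function.update (fun _ ↦ false) (chord p q β c) true) a =
        (𝕋).circleOf (Function.update (fun _ ↦ false) (chord p q β c) true) b ↔
      lvl p a.val = lvl p b.val ∨
        ((lvl p a.val = c ∨ lvl p a.val = c + 1) ∧ (lvl p b.val = c ∨ lvl p b.val = c + 1)) := by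
  rw [GaussDiagram.circleOf, GaussDiagram.circleOf, SimpleGraph.ConnectedComponent.eq]
  exact reachable_update_iff p q hpq hn β c

end Reach

end TorusGauss

end Literature.Topology.FourManifolds
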